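import Literature.NumberTheory.LFunctions.TaoEntropyDecrement
import Literature.Probability.Entropy.EntropyOfWindows
import HarnessLib

/-!
# Tao's entropy decrement argument in situ: a scale with small mutual information

Part of the proof DAG below the named fact `Literature.NumberTheory.LFunctions.Tao2016_theorem23_core` (Tao, Forum Math. Pi 4
(2016) e8, the proof of Theorem 2.3).  This file glues the two abstract halves of the entropy
decrement argument already in the tree:

* `Literature.Probability.Entropy.FiniteShannon.ent_window_mul_le` (`EntropyOfWindows.lean`): for a process `W` on a finite
  weighted set and a further random variable `Y`, approximate translation invariance of the
  conditional block entropies gives the decrement inequality (Tao 2016, §3, display before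
  (3.12)) `𝐇(X_{kH}) ≤ k (𝐇(X_H) - 𝐈(X_H : Y)) + k δ + 𝐇(Y)`;
* `Literature.NumberTheory.LFunctions.Tao2016.EntropyDecrement.exists_scale_le` (`TaoEntropyDecrement.lean`): the pigeonholing
  over scales (Lemma 3.2) turning that inequality into a scale `H` with small `𝐈(X_H : Y_H)`.

The result, `exists_scale_mutualInfo_le`, is **Lemma 3.2 as it is used in the paper** (with the
`c H / log H` right-hand side of the remark following it): given `a ≥ 1`, `H₋`, and constants
`C ≥ 1`, `c > 0`, there is `H₊₀` such that for every `H₊ ≥ H₊₀`, every finite weighted set,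
every process `W = (W_j)` whose coordinates have entropy `≤ C` ((3.8): each `g_{i,ε²}` takes
`O_ε(1)` values), and every family of random variables `Y_H` with `𝐇(Y_H) ≤ (C-1) H` ((3.10))
whose conditional block entropies are translation invariant along multiples of `H` up to an
error `δ ≤ 1/H₊` (Lemma 2.5, for `H ≥ H₋` divisible by `a`), there is a scale
`H ∈ [H₋, H₊]`, `a ∣ H`, `H ≥ 16`, with

  `𝐈(X_H : Y_H) ≤ c H / log H`,   `X_H = (W_1, …, W_H)`.

## References
* T. Tao, Forum Math. Pi 4 (2016), e8; arXiv:1509.05422, §3: (3.8), (3.10), the displays before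
  (3.12), Lemma 3.2 and the remark following it.

## Design choices
* `Y : ℕ → ι → ℕ` (`Y H` is `Y_H`; in the paper the residue `n mod P_H`, read in `ℕ`).
* The threshold `H₊₀` depends only on `(a, H₋, C, c)`, as the hierarchy of parameters of the
  paper requires (the space, the process and `δ` come after `H₊`).
-/

open Finset Real

namespace Literature.NumberTheory.LFunctions

namespace Tao2016

open Literature.Probability.Entropy.FiniteShannon

/-- **Tao 2016, Lemma 3.2 in situ.**  Let `a ≥ 1`, `H₋`, `C ≥ 1`, `c > 0`.  There is `H₊₀` such
that for all `H₊ ≥ H₊₀`: on any finite weighted set with nonnegative weights, for any process `W`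
with `𝐇(W_j) ≤ C` for all `j`, any random variables `Y_H` with `𝐇(Y_H) ≤ (C - 1) H` for
`H₋ ≤ H ≤ H₊`, and any `δ ≥ 0` with `H₊ δ ≤ 1` such that
`𝐇(X_{jH,(j+1)H} | Y_H) ≤ 𝐇(X_{0,H} | Y_H) + δ` whenever `H₋ ≤ H`, `a ∣ H`, `(j+1)H ≤ H₊`,
there is `H` with `H₋ ≤ H ≤ H₊`, `a ∣ H`, `16 ≤ H` and `𝐈(X_H : Y_H) ≤ c H / log H`.
[cite: TaoFMP2016, Lemma 3.2 and the remark following it] -/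
theorem exists_scale_mutualInfo_le {ι α : Type*} [DecidableEq α] (a : ℕ) (ha : 1 ≤ a) (Hm : ℕ)
    {C c : ℝ} (hC : 1 ≤ C) (hc : 0 < c) :
    ∃ Hp₀ : ℕ, ∀ Hp : ℕ, Hp₀ ≤ Hp →
      ∀ (s : Finset ι) (w : ι → ℝ), (∀ i ∈ s, 0 ≤ w i) →
      ∀ (W : ℕ → ι → α) (Y : ℕ → ι → ℕ),
        (∀ j, ent s w (W j) ≤ C) →
        (∀ H, Hm ≤ H → H ≤ Hp → ent s w (Y H) ≤ (C - 1) * H) →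
        ∀ δ : ℝ, 0 ≤ δ → (Hp : ℝ) * δ ≤ 1 →
        (∀ H j : ℕ, Hm ≤ H → a ∣ H → (j + 1) * H ≤ Hp →
          condEnt s w (window W (j * H) H) (Y H) ≤ condEnt s w (window W 0 H) (Y H) + δ) →
        ∃ H : ℕ, Hm ≤ H ∧ H ≤ Hp ∧ a ∣ H ∧ 16 ≤ H ∧
          mutualInfo s w (window W 0 H) (Y H) ≤ c * H / Real.log H := by
  obtain ⟨Hp₀, hmain⟩ := EntropyDecrement.exists_scale_le a ha Hm (C := C) (c := c)
    (by linarith) hc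
  refine ⟨Hp₀, fun Hp hHp s w hw W Y hB hY δ hδ0 hδ hTI => ?_⟩
  refine hmain Hp hHp (fun H => ent s w (window W 0 H))
    (fun H => mutualInfo s w (window W 0 H) (Y H)) (fun H => ent_nonneg hw) (fun H => ?_) ?_
  · -- (3.8): `𝐇(X_H) ≤ C H`
    have := ent_window_le hw W 0 H fun j _ _ => hB j
    linarith [this]
  · -- the decrement inequality from `ent_window_mul_le`
    intro H k hHm haH h16 hk hkH
    have hH1 : (1 : ℝ) ≤ H := by exact_mod_cast le_trans (by norm_num) h16
    have hHp : H ≤ Hp := le_trans (Nat.le_mul_of_pos_left H hk) hkH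
    have hTI' : ∀ j : ℕ, (j + 1) * H ≤ Hp →
        condEnt s w (window W (j * H) H) (Y H) ≤ condEnt s w (window W 0 H) (Y H) + δ :=
      fun j hj => hTI H j hHm haH hj
    have h1 := ent_window_mul_le hw W (Y H) H hTI' hkH
    have h2 := hY H hHm hHp
    -- `k δ ≤ H₊ δ ≤ 1 ≤ H`
    have hkδ : (k : ℝ) * δ ≤ 1 := by
      have hkHp : (k : ℝ) ≤ Hp := by
        exact_mod_cast le_trans (Nat.le_mul_of_pos_right k (lt_of_lt_of_le (by norm_num) h16)) hkH
      nlinarith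
    nlinarith

end Tao2016

end Literature.NumberTheory.LFunctions
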